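import Summits.BirchSwinnertonDyer.BirchSwinnertonDyer.Theorems.SignedLowerHalvesSmallImageLowerHalfBothSignsRttRecipMTValues
import Literature.NumberTheory.EllipticCurves.PAdicLFunctionFrickeSymmetryProofs
import Literature.NumberTheory.EllipticCurves.PAdicLFunctionNonvanishingProofs
import Literature.NumberTheory.EllipticCurves.CuspFormLFunctionNewformFrickeProofs
import Summits.BirchSwinnertonDyer.BirchSwinnertonDyer.Theorems.ResidualThetaTransportAtTwoThetaLayerLambdaCongruenceAtTwoDoubling
import HarnessLib

/-!
# Route `SignedLowerHalves`, crux L `SmallImageLowerHalfBothSigns` (stmt-BirchSwinnertonDyer-23599), line `rtt_w3` v40 — row S4‴ (`stub_junctionRecipValues_ns`), THE MATCH: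
# THE FUNCTIONAL EQUATION OF THE MAZUR–TATE ELEMENTS AT PRIMITIVE CHARACTERS, `θ_n(g;Ω)^φ(χ̄(γ) − 1) = σ_g·χ(M)·θ_n(g;Ω)^φ(χ(γ) − 1)`

WIDTH seat `bsd-line-slh-p3-w3` g29 under LEAD `cruxlead-stmt-BirchSwinnertonDyer-23599` g15 (cell `bsd-ssimc`; DESIGN NOTE «ORIENTATION AUDIT» 2026-08-31T15:28Z, option (a)).
Helper `--supports stmt-BirchSwinnertonDyer-23599`. THEOREMS ONLY; no definition, no named fact, no instance, no `sorry`.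

WHY. In S4‴'s value identity `hval` the Mazur–Tate side `θ_n(g;Ω)^ι(ζ − 1)` and the Coleman side `Σ_i ev_{n,i}(jv(s ζ̄_𝔞))·ζ^{pⁿ−i}` are attached to CONJUGATE characters
of `Γ` (the tree's `Λ`-action on the local dual is `(1+X)•x = x ∘ conj(γ_v)`, so the `Λ`-linear signed Coleman map is the classical one composed with the involution
`ι : (1+X) ↦ (1+X)⁻¹`; audit on the cell bus). The two orientations are bridged by the functional equation of the Mazur–Tate elements under `ι`, which is the
Atkin–Lehner symmetry of the plus modular symbols: for a newform `g ∈ S₂(Γ₀(M))` with Fricke sign `ε_g` and `m ≥ 1` prime to `M`, `[u/m]⁺ = −ε_g·[v/m]⁺` whenever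
`u·M·v ≡ −1 (mod m)` (tree: `IsFrickeEigen.plusSymbol_div_eq_neg_mul`, with `IsNewform0.frickeInvolution_eq_smul_holds`, `isFrickeEigen_of_frickeInvolution_eq_smul`; evenness `ThetaLayerLambdaCongruenceAtTwo.plusSymbolK_neg`).
CONCLUSIONS: ★ `exists_sign_plusSymbolK_fricke` — the symmetry for the `K_g`-valued symbols `[·]⁺_{g,Ω}` of a Shimura period, with a sign `σ_g ∈ {±1}`;
★★ `eval₂_mazurTateElementK_inv_eq` — for every commutative ring `R`, `φ : K_g → R`, every even `p`-power-order character `χ` mod `p^{n+e₀}` (`p ∤ M`):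
`θ_n(g;Ω)^φ(χ⁻¹(γ) − 1) = σ_g·χ(M)·θ_n(g;Ω)^φ(χ(γ) − 1)` (`γ = cyclotomicGenerator p`; reindex `a ↦ (aM)⁻¹` in `Σ_a χ(a)·φ[a/p^{n+e₀}]⁺`, `ℤ`-periodicity and evenness of
`[·]⁺`). With `χ(γ) = ζ` this is `θ_n^φ(ζ⁻¹ − 1) = σ_g·ζ^{ℓ_n(M)}·θ_n^φ(ζ − 1)` — a sign and a value of the unit `(1+X)^{ℓ(M)}`, both absorbable in S4‴'s `(c, U)`.
HONEST FRAMING: classical (Mazur–Tate–Teitelbaum §I.17); nothing about S4‴ itself is proved here; S4‴, crux L and BSD remain OPEN and are proved for NO curve.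
References: [MazurTateTeitelbaum1986Invent] §I.13, §I.17; [AtkinLehner1970] Thm. 3; [PollackWeston2011MT] §2.1–2.2.
-/

set_option autoImplicit false
set_option linter.dupNamespace false -- D-0017: single-problem summit, the namespace repeats the problem name by design
noncomputable section

open scoped Classical
open Polynomial CongruenceSubgroup Literature.NumberTheory.EllipticCurves Literature.NumberTheory.EllipticCurves.ModularForms
  Summit.BirchSwinnertonDyer.BirchSwinnertonDyer.Theorems.ResidualThetaLayer

namespace Summit.BirchSwinnertonDyer.BirchSwinnertonDyer.Theorems.SmallImageRttReciprocity

section Fricke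

variable {M : ℕ} [NeZero M] {g : CuspForm (Gamma0 M) 2} {Ω : ℂ}

/-- ★ **Atkin–Lehner symmetry of the `K_g`-valued plus symbols**: for a newform `g ∈ S₂(Γ₀(M))` and a Shimura period `Ω` there is a sign `σ ∈ {±1}` (`σ = −ε_g`, `ε_g` the
Fricke eigenvalue) with `[u/m]⁺_{g,Ω} = σ·[v/m]⁺_{g,Ω}` for all `m ≥ 1` and all integers `a, u, v` with `a·m − u·M·v = 1`.
[cite: MazurTateTeitelbaum1986Invent, §I.17] [cite: AtkinLehner1970, Thm. 3] -/
theorem exists_sign_plusSymbolK_fricke (hg : IsNewform0 g) (hΩ : IsPlusPeriod g Ω) :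
    ∃ σ : ℤ, (σ = 1 ∨ σ = -1) ∧ ∀ {m : ℕ}, 0 < m → ∀ {a u v : ℤ}, a * m - u * (M * v) = 1 →
      plusSymbolK g Ω ((u : ℚ) / m) = σ * plusSymbolK g Ω ((v : ℚ) / m) := by
  have hsm := IsNewform0.frickeInvolution_eq_smul_holds (N := M) (k := (2 : ℤ)) hg
  have hFE : IsFrickeEigen M g (frickeEigenvalue g) := isFrickeEigen_of_frickeInvolution_eq_smul M hsm
  -- `σ := -ε_g`
  obtain ⟨σ, hσ, hσε⟩ : ∃ σ : ℤ, (σ = 1 ∨ σ = -1) ∧ (frickeEigenvalue g : ℂ) = -(σ : ℂ) := by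
    rcases IsNewform0.frickeEigenvalue_eq_one_or_eq_neg_one_holds (N := M) (k := (2 : ℤ)) hg with h | h
    · exact ⟨-1, Or.inr rfl, by rw [h]; push_cast; ring⟩
    · exact ⟨1, Or.inl rfl, by rw [h]; push_cast; ring⟩
  have hε2 : (frickeEigenvalue g : ℂ) ^ 2 = 1 := by
    rw [hσε, neg_sq]; rcases hσ with h | h <;> rw [h] <;> norm_num
  refine ⟨σ, hσ, fun {m} hm {a u v} huv ↦ Subtype.ext ?_⟩
  have h := hFE.plusSymbol_div_eq_neg_mul hε2 hm huv
  rw [hσε, neg_neg] at h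
  push_cast
  rw [IsPlusPeriod.coe_plusSymbolK g hΩ, IsPlusPeriod.coe_plusSymbolK g hΩ, h, mul_div_assoc]

end Fricke

section Involution

variable {M : ℕ} [NeZero M] {g : CuspForm (Gamma0 M) 2} {p : ℕ} [Fact p.Prime] {Ω : ℂ} {R : Type*} [CommRing R] (φ : coeffField g →+* R)

/-- **`[b/m]⁺` only depends on `b mod m`** for the representatives `ZMod.val`: for an integer `v`, `[v/m]⁺_{g,Ω} = [(v mod m).val/m]⁺_{g,Ω}` (`ℤ`-periodicity).
[cite: MazurTateTeitelbaum1986Invent, §I.4] -/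
theorem plusSymbolK_intCast_div_eq_val (hΩ : IsPlusPeriod g Ω) {m : ℕ} [NeZero m] (v : ℤ) :
    plusSymbolK g Ω ((v : ℚ) / m) = plusSymbolK g Ω ((((v : ZMod m).val : ℕ) : ℚ) / m) := by
  have hm0 : (m : ℚ) ≠ 0 := Nat.cast_ne_zero.mpr (NeZero.ne m)
  have hval : (((v : ZMod m).val : ℕ) : ℤ) = v % (m : ℤ) := ZMod.val_intCast v
  have hv : (v : ℚ) / m = (((v : ZMod m).val : ℕ) : ℚ) / m + ((v / (m : ℤ) : ℤ) : ℚ) := by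
    have h := Int.emod_add_mul_ediv v m
    rw [← hval] at h
    have h' : (v : ℚ) = (((v : ZMod m).val : ℕ) : ℤ) + (m : ℚ) * ((v / (m : ℤ) : ℤ) : ℚ) := by exact_mod_cast h.symm
    rw [h']
    push_cast
    field_simp
  rw [hv, plusSymbolK_add_intCast hΩ]

/-- **Negation on representatives**: `[(−b).val/m]⁺_{g,Ω} = [b.val/m]⁺_{g,Ω}` for `b ∈ ℤ/m` (periodicity and evenness). [cite: MazurTateTeitelbaum1986Invent, §I.4] -/
theorem plusSymbolK_neg_val_div (hΩ : IsPlusPeriod g Ω) {m : ℕ} [NeZero m] (b : ZMod m) :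
    plusSymbolK g Ω ((((-b).val : ℕ) : ℚ) / m) = plusSymbolK g Ω (((b.val : ℕ) : ℚ) / m) := by
  have h1 : (((-b).val : ℕ) : ℚ) / m = ((((-(b.val : ℤ) : ℤ) : ZMod m).val : ℕ) : ℚ) / m := by
    congr 3
    push_cast
    rw [ZMod.natCast_zmod_val]
  rw [h1, ← plusSymbolK_intCast_div_eq_val hΩ, Int.cast_neg, Int.cast_natCast, neg_div, ThetaLayerLambdaCongruenceAtTwo.plusSymbolK_neg]

/-- ★★ **The functional equation of `θ_n(g;Ω)` at the characters of `Γ`**: see the module docstring. For a newform `g ∈ S₂(Γ₀(M))`, a Shimura period `Ω`, a sign `σ`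
as in `exists_sign_plusSymbolK_fricke`, a prime `p ∤ M`, any commutative ring `R` and `φ : K_g → R`, every even `R`-valued Dirichlet character `χ` mod `p^{n+e₀}` of
`p`-power order satisfies `θ_n(g;Ω)^φ(χ⁻¹(γ) − 1) = σ·χ(M)·θ_n(g;Ω)^φ(χ(γ) − 1)`. [cite: MazurTateTeitelbaum1986Invent, §I.13, §I.17] [cite: AtkinLehner1970, Thm. 3] -/
theorem eval₂_mazurTateElementK_inv_eq (hΩ : IsPlusPeriod g Ω) (hpM : ¬ p ∣ M) {σ : ℤ}
    (hσ : ∀ {m : ℕ}, 0 < m → ∀ {a u v : ℤ}, a * m - u * (M * v) = 1 → plusSymbolK g Ω ((u : ℚ) / m) = σ * plusSymbolK g Ω ((v : ℚ) / m))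
    {n : ℕ} (χ : DirichletCharacter R (p ^ (n + cyclotomicExponent p))) (heven : χ.Even) (hord : ∃ j : ℕ, orderOf χ = p ^ j) :
    (mazurTateElementK g Ω p n).eval₂ φ (χ⁻¹ (cyclotomicGenerator p : ZMod (p ^ (n + cyclotomicExponent p))) - 1) =
      (σ : R) * χ (M : ZMod (p ^ (n + cyclotomicExponent p))) *
        (mazurTateElementK g Ω p n).eval₂ φ (χ (cyclotomicGenerator p : ZMod (p ^ (n + cyclotomicExponent p))) - 1) := by
  classical
  have hp : p.Prime := Fact.out
  haveI : NeZero (p ^ (n + cyclotomicExponent p)) := ⟨pow_ne_zero _ hp.ne_zero⟩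
  have hm0 : 0 < p ^ (n + cyclotomicExponent p) := Nat.pos_of_ne_zero (NeZero.ne _)
  -- `χ⁻¹` is even of `p`-power order
  have heven' : χ⁻¹.Even := by
    rw [DirichletCharacter.Even, MulChar.inv_apply_eq_inv, heven, Ring.inverse_one]
  have hord' : ∃ j : ℕ, orderOf χ⁻¹ = p ^ j := by
    obtain ⟨j, hj⟩ := hord
    exact ⟨j, by rw [orderOf_inv, hj]⟩
  rw [eval₂_mazurTateElementK_eq_sum g Ω φ χ⁻¹ heven' hord', eval₂_mazurTateElementK_eq_sum g Ω φ χ heven hord]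
  -- `M` is a unit mod `m`
  have hMu : IsUnit ((M : ℕ) : ZMod (p ^ (n + cyclotomicExponent p))) := by
    rw [ZMod.isUnit_iff_coprime]
    exact (Nat.Coprime.pow_right _ ((Nat.Prime.coprime_iff_not_dvd hp).mpr hpM).symm)
  obtain ⟨Mu, hMu'⟩ := hMu
  -- both sums run over the units
  have hsumL : ∑ a : ZMod (p ^ (n + cyclotomicExponent p)), χ⁻¹ a * φ (plusSymbolK g Ω ((a.val : ℚ) / (p : ℚ) ^ (n + cyclotomicExponent p))) =
      ∑ u : (ZMod (p ^ (n + cyclotomicExponent p)))ˣ, χ⁻¹ (u : ZMod (p ^ (n + cyclotomicExponent p))) * φ (plusSymbolK g Ω (((u : ZMod (p ^ (n + cyclotomicExponent p))).val : ℚ) / (p : ℚ) ^ (n + cyclotomicExponent p))) := by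
    rw [sum_units_eq_sum_filter_isUnit (fun b : ZMod (p ^ (n + cyclotomicExponent p)) ↦ χ⁻¹ b * φ (plusSymbolK g Ω ((b.val : ℚ) / (p : ℚ) ^ (n + cyclotomicExponent p)))),
      Finset.sum_filter]
    refine Finset.sum_congr rfl fun a _ ↦ ?_
    split_ifs with ha
    · rfl
    · rw [MulChar.map_nonunit _ ha, zero_mul]
  have hsumR : ∑ a : ZMod (p ^ (n + cyclotomicExponent p)), χ a * φ (plusSymbolK g Ω ((a.val : ℚ) / (p : ℚ) ^ (n + cyclotomicExponent p))) =
      ∑ u : (ZMod (p ^ (n + cyclotomicExponent p)))ˣ, χ (u : ZMod (p ^ (n + cyclotomicExponent p))) * φ (plusSymbolK g Ω (((u : ZMod (p ^ (n + cyclotomicExponent p))).val : ℚ) / (p : ℚ) ^ (n + cyclotomicExponent p))) := by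
    rw [sum_units_eq_sum_filter_isUnit (fun b : ZMod (p ^ (n + cyclotomicExponent p)) ↦ χ b * φ (plusSymbolK g Ω ((b.val : ℚ) / (p : ℚ) ^ (n + cyclotomicExponent p)))),
      Finset.sum_filter]
    refine Finset.sum_congr rfl fun a _ ↦ ?_
    split_ifs with ha
    · rfl
    · rw [MulChar.map_nonunit _ ha, zero_mul]
  rw [hsumL, hsumR, Finset.mul_sum]
  -- the Fricke flip termwise: `χ⁻¹(u)·[u/m] = σ·χ((uM)⁻¹ M)… ` ; reindex by `u ↦ (u * Mu)⁻¹`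
  have hpm : ((p : ℚ) ^ (n + cyclotomicExponent p)) = ((p ^ (n + cyclotomicExponent p) : ℕ) : ℚ) := by push_cast; ring
  have hflip : ∀ u : (ZMod (p ^ (n + cyclotomicExponent p)))ˣ, φ (plusSymbolK g Ω (((u : ZMod (p ^ (n + cyclotomicExponent p))).val : ℚ) / (p : ℚ) ^ (n + cyclotomicExponent p))) =
      (σ : R) * φ (plusSymbolK g Ω (((((u * Mu)⁻¹ : (ZMod (p ^ (n + cyclotomicExponent p)))ˣ) : ZMod (p ^ (n + cyclotomicExponent p))).val : ℚ) / (p : ℚ) ^ (n + cyclotomicExponent p))) := fun u ↦ by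
    -- Bezout for `u.val * M` and `m`
    have hcop : IsCoprime ((p ^ (n + cyclotomicExponent p) : ℕ) : ℤ) ((((u : ZMod (p ^ (n + cyclotomicExponent p))).val : ℕ) : ℤ) * M) := by
      rw [← ZMod.coe_int_isUnit_iff_isCoprime]
      push_cast
      rw [ZMod.natCast_zmod_val, ← hMu']
      exact (u * Mu).isUnit
    obtain ⟨y, x, hxy⟩ := hcop
    -- `a := y`, `v := -x`: `y·m − u·(M·(−x)) = 1`
    have huv : y * ((p ^ (n + cyclotomicExponent p) : ℕ) : ℤ) - (((u : ZMod (p ^ (n + cyclotomicExponent p))).val : ℕ) : ℤ) * ((M : ℤ) * (-x)) = 1 := by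
      linear_combination hxy
    have h := hσ hm0 huv
    rw [Int.cast_natCast] at h
    rw [hpm, h, map_mul, map_intCast]
    congr 2
    -- `(-x : ZMod (p ^ (n + cyclotomicExponent p))) = -(u M)⁻¹`, then periodicity and evenness
    rw [plusSymbolK_intCast_div_eq_val hΩ]
    have hx : ((-x : ℤ) : ZMod (p ^ (n + cyclotomicExponent p))) = -((((u * Mu)⁻¹ : (ZMod (p ^ (n + cyclotomicExponent p)))ˣ) : ZMod (p ^ (n + cyclotomicExponent p)))) := by
      have h1 : ((x : ℤ) : ZMod (p ^ (n + cyclotomicExponent p))) * ((u : ZMod (p ^ (n + cyclotomicExponent p))) * (M : ZMod (p ^ (n + cyclotomicExponent p)))) = 1 := by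
        have := congr_arg (fun z : ℤ ↦ (z : ZMod (p ^ (n + cyclotomicExponent p)))) hxy
        push_cast at this
        rw [← Nat.cast_pow, ZMod.natCast_self, mul_zero, zero_add, ZMod.natCast_zmod_val] at this
        linear_combination this
      rw [Int.cast_neg, neg_inj]
      have h2 : ((x : ℤ) : ZMod (p ^ (n + cyclotomicExponent p))) * ((u * Mu : (ZMod (p ^ (n + cyclotomicExponent p)))ˣ) : ZMod (p ^ (n + cyclotomicExponent p))) = 1 := by rw [Units.val_mul, hMu']; exact h1
      calc ((x : ℤ) : ZMod (p ^ (n + cyclotomicExponent p))) = ((x : ℤ) : ZMod (p ^ (n + cyclotomicExponent p))) * (((u * Mu : (ZMod (p ^ (n + cyclotomicExponent p)))ˣ) : ZMod (p ^ (n + cyclotomicExponent p))) * (((u * Mu)⁻¹ : (ZMod (p ^ (n + cyclotomicExponent p)))ˣ) : ZMod (p ^ (n + cyclotomicExponent p)))) := by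
            rw [Units.mul_inv, mul_one]
        _ = _ := by rw [← mul_assoc, h2, one_mul]
    rw [hx, plusSymbolK_neg_val_div hΩ]
  rw [Finset.sum_congr rfl fun u _ ↦ by rw [hflip u]]
  -- reindex the left sum along the bijection `u ↦ (u * Mu)⁻¹`
  have he : ∀ u : (ZMod (p ^ (n + cyclotomicExponent p)))ˣ,
      ((Equiv.mulRight Mu).trans (Equiv.inv (ZMod (p ^ (n + cyclotomicExponent p)))ˣ)) u = (u * Mu)⁻¹ := fun _ ↦ rfl
  refine Fintype.sum_equiv ((Equiv.mulRight Mu).trans (Equiv.inv (ZMod (p ^ (n + cyclotomicExponent p)))ˣ)) _ _ fun u ↦ ?_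
  rw [he]
  -- `χ⁻¹ u = χ ((u Mu)⁻¹) · χ M`
  have hinv : χ⁻¹ (u : ZMod (p ^ (n + cyclotomicExponent p))) = χ (((u * Mu)⁻¹ : (ZMod (p ^ (n + cyclotomicExponent p)))ˣ) : ZMod (p ^ (n + cyclotomicExponent p))) * χ (M : ZMod (p ^ (n + cyclotomicExponent p))) := by
    rw [MulChar.inv_apply, Ring.inverse_unit, ← map_mul, ← hMu', ← Units.val_mul, mul_inv_rev, mul_comm Mu⁻¹, inv_mul_cancel_right]
  rw [hinv]
  ring

end Involution

end Summit.BirchSwinnertonDyer.BirchSwinnertonDyer.Theorems.SmallImageRttReciprocity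

end
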